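import Summits.Ventures.HodgeRepro2.T5SU11LegendreShiftedBridge
import Summits.Ventures.HodgeRepro2.T5SU11LegendreDerivativeBound

/-!
# The derivatives of `P_n` at `1`: `P_n^{(k)}(1) = k! C(n,k) C(n+k,n)/2^k = (n+k)!/(2^k k! (n−k)!)`, and the sharp
bound `|P_n^{(k)}(x)| ≤ (n+k)!/(2^k k! (n−k)!)` on `[−1, 1]`

Row 377's closed form `P_n(x) = Σ_{k ≤ n} C(n,k) C(n+k,n) ((x − 1)/2)^k` is the Taylor expansion of `P_n` at `1`; as a
polynomial identity (`legPoly_eq_sum_X_sub_one`) it gives the iterated derivatives at `1` directly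
(`Polynomial.iterate_derivative_X_sub_pow`): only the term `k = j` survives at `x = 1`, so

  **`P_n^{(j)}(1) = j! · C(n,j) · C(n+j,n)/2^j`**   (`eval_legD_one`),
  **`P_n^{(j)}(1) = (n+j)!/(2^j · j! · (n−j)!)` for `j ≤ n`**, and `= 0` for `j > n`   (`eval_legD_one_factorial`, `eval_legD_one_of_lt`);

with row 416's `|P_n^{(j)}(x)| ≤ P_n^{(j)}(1)` this is the explicit Markov-type bound

  **`|P_n^{(j)}(x)| ≤ (n+j)!/(2^j · j! · (n−j)!)` on `[−1, 1]`**   (`abs_eval_legD_le_factorial`),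

`j = 1` being `n(n+1)/2` (row 404) and `j = 2` being `(n−1)n(n+1)(n+2)/8`. Nothing is claimed about (N).

Blind lane: Mathlib + the HodgeRepro2 prefix only; no sorry; axioms ⊆ {propext, Classical.choice,
Quot.sound}.
-/

namespace Summit.Ventures.HodgeRepro2.T5SU11LegendreDerivativeAtOne

open Polynomial Finset Set
open T5SU11SphericalLegendreAll T5SU11JacobiPhaseLawEven T5SU11LegendreShiftedBridge T5SU11LegendreTuran
  T5SU11LegendreDerivativeBound

/-- **`legPoly n = Σ_{k ≤ n} C(C(n,k) C(n+k,n)/2^k) · (X − 1)^k`**: the Taylor expansion at `1`, as polynomials. -/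
theorem legPoly_eq_sum_X_sub_one (n : ℕ) :
    legPoly n = ∑ k ∈ range (n + 1), C ((n.choose k : ℝ) * ((n + k).choose n : ℝ) / 2 ^ k) * (X - C 1) ^ k := by
  apply Polynomial.funext
  intro x
  rw [← legP_eq_eval, legP_eq_sum, eval_finsetSum]
  refine Finset.sum_congr rfl fun k _ => ?_
  rw [eval_mul, eval_C, eval_pow, eval_sub, eval_X, eval_C, div_pow]
  ring

/-- **`P_n^{(j)}(1) = j! · C(n,j) · C(n+j,n)/2^j`.** -/
theorem eval_legD_one (n j : ℕ) :
    (legD n j).eval 1 = (j.factorial : ℝ) * ((n.choose j : ℝ) * ((n + j).choose n : ℝ) / 2 ^ j) := by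
  rw [legD, legPoly_eq_sum_X_sub_one, iterate_derivative_sum, eval_finsetSum]
  simp_rw [iterate_derivative_C_mul, iterate_derivative_X_sub_pow, eval_mul, eval_C, eval_smul, eval_pow, eval_sub,
    eval_X, eval_C, sub_self, nsmul_eq_mul]
  rw [Finset.sum_eq_single j]
  · rw [Nat.sub_self, pow_zero, Nat.descFactorial_self]
    ring
  · intro k _ hkj
    rcases lt_or_gt_of_ne hkj with h | h
    · rw [Nat.descFactorial_eq_zero_iff_lt.mpr h]
      simp
    · rw [zero_pow (by omega)]
      simp
  · intro hj
    -- `j > n`: both sides vanish (`C(n, j) = 0`)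
    rw [Finset.mem_range, not_lt] at hj
    rw [Nat.choose_eq_zero_of_lt (by omega)]
    simp

/-- **`P_n^{(j)}(1) = (n+j)!/(2^j · j! · (n−j)!)` for `j ≤ n`.** -/
theorem eval_legD_one_factorial {n j : ℕ} (hj : j ≤ n) :
    (legD n j).eval 1 = ((n + j).factorial : ℝ) / (2 ^ j * (j.factorial : ℝ) * ((n - j).factorial : ℝ)) := by
  rw [eval_legD_one]
  have h1 : (n.choose j : ℝ) = (n.factorial : ℝ) / ((j.factorial : ℝ) * ((n - j).factorial : ℝ)) := by
    rw [eq_div_iff (by positivity), ← mul_assoc]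
    exact_mod_cast Nat.choose_mul_factorial_mul_factorial hj
  have h2 : ((n + j).choose n : ℝ) = ((n + j).factorial : ℝ) / ((n.factorial : ℝ) * (j.factorial : ℝ)) := by
    rw [eq_div_iff (by positivity), ← mul_assoc, Nat.choose_symm_add]
    exact_mod_cast Nat.add_choose_mul_factorial_mul_factorial n j
  rw [h1, h2]
  have hj0 : (j.factorial : ℝ) ≠ 0 := by positivity
  have hn0 : (n.factorial : ℝ) ≠ 0 := by positivity
  have hnj0 : ((n - j).factorial : ℝ) ≠ 0 := by positivity
  field_simp

/-- **`P_n^{(j)}(1) = 0` for `j > n`** (indeed `P_n^{(j)} = 0`). -/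
theorem eval_legD_one_of_lt {n j : ℕ} (hj : n < j) : (legD n j).eval 1 = 0 := by
  rw [eval_legD_one, Nat.choose_eq_zero_of_lt hj]
  simp

/-- **The explicit Markov-type bound**: `|P_n^{(j)}(x)| ≤ (n+j)!/(2^j · j! · (n−j)!)` on `[−1, 1]` for `j ≤ n`. -/
theorem abs_eval_legD_le_factorial {n j : ℕ} (hj : j ≤ n) {x : ℝ} (hx : x ∈ Icc (-1 : ℝ) 1) :
    |(legD n j).eval x| ≤ ((n + j).factorial : ℝ) / (2 ^ j * (j.factorial : ℝ) * ((n - j).factorial : ℝ)) := by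
  rw [← eval_legD_one_factorial hj]
  exact abs_eval_legD_le n j hx

/-- The cross-checks `j = 1`: `n(n + 1)/2`; `j = 2`: `(n − 1) n (n + 1)(n + 2)/8` (for `n ≥ 2`). -/
theorem eval_legD_one_one_two (n : ℕ) :
    (legD n 1).eval 1 = (n : ℝ) * (n + 1) / 2
      ∧ (2 ≤ n → (legD n 2).eval 1 = ((n : ℝ) - 1) * n * (n + 1) * (n + 2) / 8) := by
  constructor
  · rw [legD_one, eval_derivative_legPoly, T5SU11LegendreDerivativeSum.legQ_one_eq]
  · intro hn
    rw [eval_legD_one_factorial (by omega)]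
    obtain ⟨m, rfl⟩ : ∃ m, n = m + 2 := ⟨n - 2, by omega⟩
    rw [show m + 2 + 2 = m + 4 by ring, show m + 2 - 2 = m by omega, Nat.factorial_succ (m + 3),
      Nat.factorial_succ (m + 2), Nat.factorial_succ (m + 1), Nat.factorial_succ m]
    push_cast
    have : (m.factorial : ℝ) ≠ 0 := by positivity
    field_simp
    ring

end Summit.Ventures.HodgeRepro2.T5SU11LegendreDerivativeAtOne
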